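import Summits.Ventures.HSemireg.WedgeHankelRecurrenceCayleyTransform
import Summits.Ventures.HSemireg.WedgeHankelRecurrenceRouthHurwitzLowDegree

/-!
# Venture HSemireg — JURY'S TEST IN DEGREE TWO via the Cayley transform: **the real polynomial `z² + a z + b` is a Schur polynomial iff `|a| < 1 + b` and `b < 1`**, read off N205
# (`p` Schur ⟺ `(z−1)² p((z+1)/(z−1))` Hurwitz) and N196 (degree-two Routh–Hurwitz), with the general-leading-coefficient form of the degree-two Hurwitz criterion on the way

HONEST FRAMING. Part of the Lean index of the computation cell `pub-hsemireg` (seat p10 gen 38, Sunday typer «UNIFORM-IN-n»).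
REAL ∕ COMPLEX POLYNOMIALS ONLY: no variety, no cohomology theory, no sheaf, no Ext group and no semiregularity map is constructed here; nothing here says that HC / HC_CM / HC_AV holds; no Literature
fact (unproved `Prop`) is declared or used.  Custodian versions as in `WedgeHankelSiegelIdeal` (1/3).
SOURCE (cited; held text read): P. A. Fuhrmann, U. Helmke (2015) §5.6 Exercise 14 (chunk p0267; typed as N205 `forall_norm_lt_one_iff_cayleyPoly_real`) and §5.5 p. 261 (degree-two Hurwitz test,
typed as N196 `forall_re_neg_quadratic_iff`).  THIS FILE (elementary corollary; the degree-two Schur ∕ Jury conditions `|a_1| < 1 + a_0`, `|a_0| < 1` are classical — E. I. Jury 1964 — no held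
locus is claimed beyond F–H): `cayleyPoly 2 (X² + aX + b) = (1+a+b) X² + 2(1−b) X + (1−a+b)` and the sign bookkeeping.
DEDUP DISCLOSURE (`rg` of the whole tree + Mathlib, 2026-09-02): N196 ∕ Literature `RouthHurwitzLowOrder` have the degree-two HURWITZ tests (monic); no degree-two SCHUR test anywhere.  4 names:
0 hits tree-wide + Mathlib.

WHAT IS IN THE TREE.  N205 `cayleyPoly`, `forall_norm_lt_one_iff_cayleyPoly_real`; N196 `forall_re_neg_quadratic_iff`; Mathlib `roots_C_mul`, `Polynomial.map_mul`.
THIS FILE (namespace `Summit.Ventures.HSemireg.Wedge.HankelOuter` continued; CHAINED on N205 + N196; 0 definitions):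
* §905 `cayleyPoly_two_quadratic` (the explicit transform), `forall_re_neg_quadratic_iff_of_ne_zero` (Hurwitz for `αX² + βX + γ`, `α ≠ 0`: `0 < β/α ∧ 0 < γ/α`),
  **`forall_norm_lt_one_quadratic_iff`** (Jury: Schur ⟺ `|a| < 1 + b ∧ b < 1`), `forall_norm_lt_one_quadratic_iff'` (equivalently `|b| < 1 ∧ |a| < 1 + b`).
CAVEATS.  Degree two only; nothing Ext-side.  New names only.
-/

open Module Polynomial
open scoped Matrix Polynomial

namespace Summit.Ventures.HSemireg.Wedge.HankelOuter

open Summit.Ventures.HSemireg.Wedge Summit.Ventures.HSemireg.Wedge.Hankel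

/-! ## §905. Degree two -/

/-- **`cayleyPoly 2 (X² + aX + b) = (1 + a + b) X² + 2(1 − b) X + (1 − a + b)`.** [this file §905] -/
theorem cayleyPoly_two_quadratic {R : Type*} [CommRing R] (a b : R) :
    cayleyPoly 2 (Polynomial.X ^ 2 + C a * Polynomial.X + C b) = C (1 + a + b) * Polynomial.X ^ 2 + C (2 * (1 - b)) * Polynomial.X + C (1 - a + b) := by
  unfold cayleyPoly
  simp only [Finset.sum_range_succ, Finset.sum_range_zero, zero_add, coeff_add, coeff_X_pow, coeff_C_mul, coeff_X, coeff_C]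
  norm_num
  have h2 : (C 2 : R[X]) = 2 := C_ofNat 2
  rw [h2]
  ring

/-- **Degree-two Hurwitz test with any leading coefficient: for `α ≠ 0`, `αX² + βX + γ` is a Hurwitz polynomial iff `β/α > 0` and `γ/α > 0`** (all coefficients of one sign). [N196 rescaled;
this file §905] -/
theorem forall_re_neg_quadratic_iff_of_ne_zero {α β γ : ℝ} (hα : α ≠ 0) :
    (∀ z ∈ ((C α * Polynomial.X ^ 2 + C β * Polynomial.X + C γ : ℝ[X]).map (algebraMap ℝ ℂ)).roots, z.re < 0) ↔ 0 < β / α ∧ 0 < γ / α := by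
  have hfac : (C α * Polynomial.X ^ 2 + C β * Polynomial.X + C γ : ℝ[X]) = C α * (Polynomial.X ^ 2 + C (β / α) * Polynomial.X + C (γ / α)) := by
    rw [mul_add, mul_add, ← mul_assoc, ← C_mul, ← C_mul, mul_div_cancel₀ _ hα, mul_div_cancel₀ _ hα]
  have hroots : ((C α * Polynomial.X ^ 2 + C β * Polynomial.X + C γ : ℝ[X]).map (algebraMap ℝ ℂ)).roots =
      ((Polynomial.X ^ 2 + C (β / α) * Polynomial.X + C (γ / α) : ℝ[X]).map (algebraMap ℝ ℂ)).roots := by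
    rw [hfac, Polynomial.map_mul, map_C, roots_C_mul _ ((map_ne_zero_iff _ (RingHom.injective _)).2 hα)]
  rw [hroots, forall_re_neg_quadratic_iff]

/-- **JURY'S TEST, DEGREE TWO: the real polynomial `z² + a z + b` has both roots in the open unit disc iff `|a| < 1 + b` and `b < 1`.** (Cayley transform N205 + the degree-two Hurwitz test; `p(1) =
1 + a + b`.) [F–H §5.6 Ex. 14 + §5.5; this file §905] -/
theorem forall_norm_lt_one_quadratic_iff (a b : ℝ) :
    (∀ z ∈ ((Polynomial.X ^ 2 + C a * Polynomial.X + C b : ℝ[X]).map (algebraMap ℝ ℂ)).roots, ‖z‖ < 1) ↔ |a| < 1 + b ∧ b < 1 := by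
  set p : ℝ[X] := Polynomial.X ^ 2 + C a * Polynomial.X + C b with hpdef
  have hp : p.natDegree = 2 := by
    rw [hpdef]; compute_degree!
  have hp1 : p.eval 1 = 1 + a + b := by rw [hpdef]; simp only [eval_add, eval_pow, eval_mul, eval_C, eval_X]; ring
  have hp0 : p ≠ 0 := by rintro h0; rw [h0, natDegree_zero] at hp; exact absurd hp (by norm_num)
  constructor
  · intro h
    -- `p(1) ≠ 0`, since `1` is not in the open unit disc
    have h1 : p.eval 1 ≠ 0 := fun h0 => by
      have hmem : (1 : ℂ) ∈ (p.map (algebraMap ℝ ℂ)).roots := by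
        rw [mem_roots ((Polynomial.map_ne_zero_iff (RingHom.injective _)).2 hp0), IsRoot.def, eval_map, ← map_one (algebraMap ℝ ℂ), eval₂_hom, h0, map_zero]
      have := h 1 hmem
      rw [norm_one] at this
      exact lt_irrefl _ this
    have hq := (forall_norm_lt_one_iff_cayleyPoly_real hp h1).1 h
    rw [hpdef, cayleyPoly_two_quadratic, forall_re_neg_quadratic_iff_of_ne_zero (by rw [← hp1]; exact h1)] at hq
    obtain ⟨hβ, hγ⟩ := hq
    rw [hp1] at h1
    rcases lt_or_gt_of_ne h1 with hneg | hpos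
    · exfalso
      have h2 : 1 - b < 0 := by
        have := div_pos_iff.1 hβ
        rcases this with ⟨h3, h4⟩ | ⟨h3, h4⟩
        · linarith
        · linarith
      have h3 : 1 - a + b < 0 := by
        rcases div_pos_iff.1 hγ with ⟨h3, h4⟩ | ⟨h3, h4⟩
        · linarith
        · exact h3
      linarith
    · have h2 : 0 < 1 - b := by
        rcases div_pos_iff.1 hβ with ⟨h3, h4⟩ | ⟨h3, h4⟩
        · linarith
        · linarith
      have h3 : 0 < 1 - a + b := by
        rcases div_pos_iff.1 hγ with ⟨h3, h4⟩ | ⟨h3, h4⟩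
        · exact h3
        · linarith
      refine ⟨abs_lt.2 ⟨by linarith, by linarith⟩, by linarith⟩
  · rintro ⟨ha, hb⟩
    obtain ⟨ha1, ha2⟩ := abs_lt.1 ha
    have h1 : p.eval 1 ≠ 0 := by rw [hp1]; linarith
    refine (forall_norm_lt_one_iff_cayleyPoly_real hp h1).2 ?_
    rw [hpdef, cayleyPoly_two_quadratic, forall_re_neg_quadratic_iff_of_ne_zero (show (1 + a + b) ≠ 0 by linarith)]
    exact ⟨div_pos (by linarith) (by linarith), div_pos (by linarith) (by linarith)⟩

/-- The same test in the symmetric form **`|b| < 1 ∧ |a| < 1 + b`**. [this file §905] -/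
theorem forall_norm_lt_one_quadratic_iff' (a b : ℝ) :
    (∀ z ∈ ((Polynomial.X ^ 2 + C a * Polynomial.X + C b : ℝ[X]).map (algebraMap ℝ ℂ)).roots, ‖z‖ < 1) ↔ |b| < 1 ∧ |a| < 1 + b := by
  rw [forall_norm_lt_one_quadratic_iff, abs_lt, abs_lt]
  constructor
  · rintro ⟨⟨h1, h2⟩, h3⟩; exact ⟨⟨by linarith, h3⟩, h1, h2⟩
  · rintro ⟨⟨h1, h2⟩, h3, h4⟩; exact ⟨⟨h3, h4⟩, h2⟩

end Summit.Ventures.HSemireg.Wedge.HankelOuter
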